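import Mathlib
import Summits.ValiantsHypothesis.ValiantsHypothesis.Theorems.BarrierLeverPartitionMinorsHitByVPHiddenStatesBallCutThirdShellReduction

/-!
# Route BarrierLever — item `PartitionMinorsHitByVP` (stmt-ValiantsHypothesis-19717), line `hidden-states`:
# ★ FOURTH SHELL — every 4-swap family with a DOUBLY BALANCED coordinate is served (all `t, h`)

Helper file (`--supports stmt-ValiantsHypothesis-19717`; cell valiant-natproofs, 𝒟-side door (c), registered line
`Cruxes/PartitionMinorsHitByVP/Lines/hidden_states.lean` v9; prover seat val-np-p6 gen 21).  Closes NO item; definition-free.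

THE THEOREM (memo HOME/val-np-p6/g21/MEMO-valnp6-g21.md §2).  `𝒰 = B_t(h) ∖ {A_1..A_4} ∪ {C_1..C_4}` (`|A_l| = t`, `|C_l| = t + 1`, injective,
`A_l ⊄ C_{l'}`) and a coordinate `x` lying in exactly TWO of the `A_l` and exactly TWO of the `C_l`.  Then every injective row family in
`𝒰` with columns covering `B_t(h)` is served: ★ `exists_table_fourSwap_of_doublyBalanced` — the first unconditional cell of the FOURTH
shell.  PROOF = the balanced cut `BallCut.served_of_erase_balanced` at `x`: LINK and DELETION are both 2-swap families on `Fin h ∖ {x}`,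
served by the landed second shell (`BallCut.served_small_on`).  More generally `exists_table_multiSwap_of_balanced_le_two`: an m-swap
family with a balanced coordinate of multiplicity `k` with `1 ≤ k ≤ 2` and `1 ≤ m - k ≤ 2` is served (`m ∈ {2, 3, 4}`).

HONEST LABEL: a cell of the conjecture column (fourth shell); 19717 stays OPEN; nothing on crux 14610 or VP ≠ VNP.
-/

set_option linter.dupNamespace false

namespace Summit.ValiantsHypothesis.ValiantsHypothesis.Theorems.BarrierLever.HiddenStates

open Finset

noncomputable section

namespace BallCut

open SymbJoin

/-- ★ **m-swap families with a balanced coordinate of multiplicity `k`, `k ∈ {1,2}`, `m - k ∈ {1,2}`, are served** (all `t, h`). -/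
theorem exists_table_multiSwap_of_balanced_le_two (h t : ℕ) {m : ℕ} (A C : Fin m → Finset (Fin h))
    (hA : ∀ l, (A l).card = t) (hC : ∀ l, (C l).card = t + 1)
    (hAi : Function.Injective A) (hCi : Function.Injective C) (hAC : ∀ l l', ¬ A l ⊆ C l')
    (x : Fin h) (hbal : (Finset.univ.filter fun l => x ∈ A l).card = (Finset.univ.filter fun l => x ∈ C l).card)
    (hk : (Finset.univ.filter fun l => x ∈ A l).card = 1 ∨ (Finset.univ.filter fun l => x ∈ A l).card = 2)
    (hk' : (Finset.univ.filter fun l => x ∉ A l).card = 1 ∨ (Finset.univ.filter fun l => x ∉ A l).card = 2)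
    {r : ℕ} (u cols : Fin r → Finset (Fin h)) (hu : Function.Injective u)
    (hU : ∀ i, ((u i).card ≤ t ∧ ∀ l, u i ≠ A l) ∨ ∃ l, u i = C l)
    (hcols : ∀ J : Finset (Fin h), J.card ≤ t → ∃ kk, cols kk = J) :
    ∃ tx : Option (Fin h) → Fin h → ℂ,
      (Matrix.of fun i kk : Fin r => ∏ a ∈ u i, (tx none a + ∑ q ∈ cols kk, tx (some q) a)).det ≠ 0 := by
  classical
  obtain ⟨k, hkA⟩ : ∃ k, (Finset.univ.filter fun l => x ∈ A l).card = k := ⟨_, rfl⟩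
  have hkC : (Finset.univ.filter fun l => x ∈ C l).card = k := by rw [← hbal]; exact hkA
  obtain ⟨k', hk'A⟩ : ∃ k', (Finset.univ.filter fun l => x ∉ A l).card = k' := ⟨_, rfl⟩
  have hkk' : k + k' = m := by
    have := Finset.card_filter_add_card_filter_not (s := (Finset.univ : Finset (Fin m))) (fun l => x ∈ A l)
    rw [hkA, hk'A] at this; simpa using this
  have hk'C : (Finset.univ.filter fun l => x ∉ C l).card = k' := by
    have := Finset.card_filter_add_card_filter_not (s := (Finset.univ : Finset (Fin m))) (fun l => x ∈ C l)
    rw [hkC] at this; simp only [Finset.card_univ, Fintype.card_fin] at this; omega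
  have hk12 : k = 1 ∨ k = 2 := by rw [hkA] at hk; exact hk
  have hk'12 : k' = 1 ∨ k' = 2 := by rw [hk'A] at hk'; exact hk'
  -- `t = t' + 1`
  have hne : (Finset.univ.filter fun l => x ∈ A l).Nonempty := by
    rw [← Finset.card_pos, hkA]; rcases hk12 with h1 | h2 <;> omega
  obtain ⟨l₀, hl₀⟩ := hne
  have hxl₀ : x ∈ A l₀ := (Finset.mem_filter.1 hl₀).2
  obtain ⟨t', rfl⟩ : ∃ t', t = t' + 1 :=
    ⟨t - 1, by have := Finset.card_pos.2 ⟨x, hxl₀⟩; rw [hA l₀] at this; omega⟩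
  obtain ⟨hcinj, hUr, hJr⟩ := rigidity (t' + 1) A C hA hC hAi hCi u cols hu hU hcols
  rw [exists_table_iff_symGood]
  refine served_of_erase_balanced t' A C hA hC hAi hCi Finset.univ x (Finset.mem_univ x) (fun l => Finset.subset_univ _)
    hbal ?_ ?_ u cols hu hcinj (fun U => by rw [hUr U]; simp) (fun J => by rw [hJr J]; simp)
  · -- THE LINK: the `k` swaps through `x`, `x` erased
    intro r' u' cols' hu' hc' hU' hJ'
    let eA : Fin k ↪o Fin m := (Finset.univ.filter fun l => x ∈ A l).orderEmbOfFin hkA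
    let eC : Fin k ↪o Fin m := (Finset.univ.filter fun l => x ∈ C l).orderEmbOfFin hkC
    have heA : ∀ j, x ∈ A (eA j) := fun j =>
      (Finset.mem_filter.1 (Finset.orderEmbOfFin_mem (Finset.univ.filter fun l => x ∈ A l) hkA j)).2
    have heC : ∀ j, x ∈ C (eC j) := fun j =>
      (Finset.mem_filter.1 (Finset.orderEmbOfFin_mem (Finset.univ.filter fun l => x ∈ C l) hkC j)).2
    have heAsur : ∀ l, x ∈ A l → ∃ j, eA j = l := fun l hl => by
      have : l ∈ Set.range eA := by
        rw [show Set.range eA = ↑(Finset.univ.filter fun l => x ∈ A l) from Finset.range_orderEmbOfFin _ hkA]; simp [hl]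
      exact this
    have heCsur : ∀ l, x ∈ C l → ∃ j, eC j = l := fun l hl => by
      have : l ∈ Set.range eC := by
        rw [show Set.range eC = ↑(Finset.univ.filter fun l => x ∈ C l) from Finset.range_orderEmbOfFin _ hkC]; simp [hl]
      exact this
    let A₁ : Fin k → Finset (Fin h) := fun j => (A (eA j)).erase x
    let C₁ : Fin k → Finset (Fin h) := fun j => (C (eC j)).erase x
    have hA₁ : ∀ j, (A₁ j).card = t' := fun j => by
      have := Finset.card_erase_of_mem (heA j); simp only [A₁]; rw [this, hA]; rfl
    have hC₁ : ∀ j, (C₁ j).card = t' + 1 := fun j => by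
      have := Finset.card_erase_of_mem (heC j); simp only [C₁]; rw [this, hC]; rfl
    have hA₁i : Function.Injective A₁ := fun j j' hjj' => eA.injective (hAi (by
      rw [← Finset.insert_erase (heA j), ← Finset.insert_erase (heA j')]; exact congrArg _ hjj'))
    have hC₁i : Function.Injective C₁ := fun j j' hjj' => eC.injective (hCi (by
      rw [← Finset.insert_erase (heC j), ← Finset.insert_erase (heC j')]; exact congrArg _ hjj'))
    have hA₁C₁ : ∀ j j', ¬ A₁ j ⊆ C₁ j' := fun j j' hsub => hAC (eA j) (eC j') (by
      rw [← Finset.insert_erase (heA j), ← Finset.insert_erase (heC j')]; exact Finset.insert_subset_insert x hsub)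
    refine served_small_on t' (Finset.univ.erase x) hk12 A₁ C₁ hA₁ hC₁ hA₁i hC₁i hA₁C₁
      (fun j => Finset.erase_subset_erase x (Finset.subset_univ _)) (fun j => Finset.erase_subset_erase x (Finset.subset_univ _))
      u' cols' hu' (fun U => ?_) hJ'
    rw [hU' U]
    have e1 : (∀ l, x ∈ A l → U ≠ (A l).erase x) ↔ ∀ j, U ≠ A₁ j :=
      ⟨fun H' j => H' (eA j) (heA j), fun H' l hl => by obtain ⟨j, rfl⟩ := heAsur l hl; exact H' j⟩
    have e2 : (∃ l, x ∈ C l ∧ U = (C l).erase x) ↔ ∃ j, U = C₁ j :=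
      ⟨fun ⟨l, hl, hU''⟩ => by obtain ⟨j, rfl⟩ := heCsur l hl; exact ⟨j, hU''⟩, fun ⟨j, hU''⟩ => ⟨eC j, heC j, hU''⟩⟩
    rw [e1, e2]
  · -- THE DELETION: the `k'` swaps avoiding `x`
    intro r' u' cols' hu' hc' hU' hJ'
    let eA : Fin k' ↪o Fin m := (Finset.univ.filter fun l => x ∉ A l).orderEmbOfFin hk'A
    let eC : Fin k' ↪o Fin m := (Finset.univ.filter fun l => x ∉ C l).orderEmbOfFin hk'C
    have heA : ∀ j, x ∉ A (eA j) := fun j =>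
      (Finset.mem_filter.1 (Finset.orderEmbOfFin_mem (Finset.univ.filter fun l => x ∉ A l) hk'A j)).2
    have heC : ∀ j, x ∉ C (eC j) := fun j =>
      (Finset.mem_filter.1 (Finset.orderEmbOfFin_mem (Finset.univ.filter fun l => x ∉ C l) hk'C j)).2
    have heAsur : ∀ l, x ∉ A l → ∃ j, eA j = l := fun l hl => by
      have : l ∈ Set.range eA := by
        rw [show Set.range eA = ↑(Finset.univ.filter fun l => x ∉ A l) from Finset.range_orderEmbOfFin _ hk'A]; simp [hl]
      exact this
    have heCsur : ∀ l, x ∉ C l → ∃ j, eC j = l := fun l hl => by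
      have : l ∈ Set.range eC := by
        rw [show Set.range eC = ↑(Finset.univ.filter fun l => x ∉ C l) from Finset.range_orderEmbOfFin _ hk'C]; simp [hl]
      exact this
    refine served_small_on (t' + 1) (Finset.univ.erase x) hk'12 (fun j => A (eA j)) (fun j => C (eC j))
      (fun j => hA _) (fun j => hC _) (fun j j' hjj' => eA.injective (hAi hjj')) (fun j j' hjj' => eC.injective (hCi hjj'))
      (fun j j' => hAC _ _)
      (fun j a ha => Finset.mem_erase.2 ⟨fun hax => heA j (hax ▸ ha), Finset.mem_univ _⟩)
      (fun j a ha => Finset.mem_erase.2 ⟨fun hax => heC j (hax ▸ ha), Finset.mem_univ _⟩)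
      u' cols' hu' (fun U => ?_) hJ'
    rw [hU' U]
    have e1 : (∀ l, x ∉ A l → U ≠ A l) ↔ ∀ j, U ≠ A (eA j) :=
      ⟨fun H' j => H' (eA j) (heA j), fun H' l hl => by obtain ⟨j, rfl⟩ := heAsur l hl; exact H' j⟩
    have e2 : (∃ l, x ∉ C l ∧ U = C l) ↔ ∃ j, U = C (eC j) :=
      ⟨fun ⟨l, hl, hU''⟩ => by obtain ⟨j, rfl⟩ := heCsur l hl; exact ⟨j, hU''⟩, fun ⟨j, hU''⟩ => ⟨eC j, heC j, hU''⟩⟩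
    rw [e1, e2]

/-- ★ **FOURTH SHELL, DOUBLY BALANCED COORDINATE.**  Four swaps and a coordinate `x` in exactly two of the `A_l` and exactly two of the
`C_l`: the family `B_t(h) ∖ {A_l} ∪ {C_l}` is served. -/
theorem exists_table_fourSwap_of_doublyBalanced (h t : ℕ) (A C : Fin 4 → Finset (Fin h))
    (hA : ∀ l, (A l).card = t) (hC : ∀ l, (C l).card = t + 1)
    (hAi : Function.Injective A) (hCi : Function.Injective C) (hAC : ∀ l l', ¬ A l ⊆ C l')
    (x : Fin h) (hkA : (Finset.univ.filter fun l => x ∈ A l).card = 2) (hkC : (Finset.univ.filter fun l => x ∈ C l).card = 2)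
    {r : ℕ} (u cols : Fin r → Finset (Fin h)) (hu : Function.Injective u)
    (hU : ∀ i, ((u i).card ≤ t ∧ ∀ l, u i ≠ A l) ∨ ∃ l, u i = C l)
    (hcols : ∀ J : Finset (Fin h), J.card ≤ t → ∃ kk, cols kk = J) :
    ∃ tx : Option (Fin h) → Fin h → ℂ,
      (Matrix.of fun i kk : Fin r => ∏ a ∈ u i, (tx none a + ∑ q ∈ cols kk, tx (some q) a)).det ≠ 0 := by
  have hk' : (Finset.univ.filter fun l => x ∉ A l).card = 2 := by
    have := Finset.card_filter_add_card_filter_not (s := (Finset.univ : Finset (Fin 4))) (fun l => x ∈ A l)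
    rw [hkA] at this; simp only [Finset.card_univ, Fintype.card_fin] at this; omega
  exact exists_table_multiSwap_of_balanced_le_two h t A C hA hC hAi hCi hAC x (hkA.trans hkC.symm) (Or.inr hkA) (Or.inr hk')
    u cols hu hU hcols

end BallCut

end

end Summit.ValiantsHypothesis.ValiantsHypothesis.Theorems.BarrierLever.HiddenStates
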